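import Literature.Computability.Complexity.CodeFPListKit
import Literature.Computability.Complexity.CodeFPArith
import Summits.PneNP.PneNP.Theorems.Nc03AvoidResidualCoreCandFewHeadsRungFP

/-!
# Line «sfm-bl», MACHINE LAYER M1: legs and block splitting in the `CodeFP` algebra (stmt-PneNP-20523)

FRONTIER F-N1c; nothing here bears on P vs NP.

MACHINE-PLAN (pnp-ideate-p3 g14, `HOME/pnp-ideate-p3/r15/MACHINE-PLAN.md`) stage **M1**.  Input: the decoded
data of a pure-`CAND` instance, the list of triples `trips I = [(c_j, a_j, b_j)]_{j<m}` of the landed decoder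
(`Nc03AvoidResidualCoreCandFewHeadsRungFPDecode`: `tripsTok (toks I) = trips I`, typed `codeFP_tripsTok`).
LEGS are indexed `i = 3j + t`, `t ∈ {0,1,2}` (output `j`, position `t`); the LEFT vertex of every leg of output
`j` is the head `c_j`; the RIGHT vertex is coded in `ℕ` as `0` = the constant column (`t = 0`), `a_j + 1`
(`t = 1`), `b_j + 1` (`t = 2`) — the dictionary of `SfmBlLegCounts.not_mem_range_of_sgnMat_cut_lt`
(`Option (Fin n)` coded by `none ↦ 0`, `some v ↦ v + 1`).  BLOCK SPLITTING (`SfmBlBlockSplit`): the rank of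
a leg in its left (right) fibre is the number of EARLIER legs (smaller index) with the same left (right)
vertex; the leg goes to block `rank / L` of its vertex.

Definitions (plain list functions, the SPEC of the machine): `lvert`, `rvert`, `rankL`, `rankR`,
`pleg L trips i = (j, t, c, rankL / L, v, rankR / L)`, `pieceLegs L trips` (all `3m` legs with their piece
labels).  Theorems: each is computed on codes by a polynomial-time string function (`codeFP_…`, binary
numerals `natE`; triples re-coded from the decoder's unary `tripE` by `codeFP_tripsN`), and the index
lemmas `length_pieceLegs`, `pieceLegs_getElem`, `lvert_trips`, `rvert_trips_*`, `rankL_eq_countP` used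
downstream (M2: the piece multigraph; M5: the dictionary to `SfmBlBlockSplit.fiberRank`).
-/

set_option linter.dupNamespace false -- `Summit.PneNP.PneNP.…`: summit = sub-problem name (D-0017 single-conjunct layout)

namespace Summit.PneNP.PneNP.Theorems.SfmBlMachine

open Literature.Computability.Complexity CodeFP
open Summit.PneNP.PneNP.Theorems.Nc03AvoidResidualCoreCandFewHeadsRungFP

/-! ## The spec: legs, vertices, ranks, pieces (plain list functions) -/

/-- Left vertex of leg `i` (= head `c_j` of output `j = i / 3`; `0` past the end). -/
def lvert (trips : List (ℕ × ℕ × ℕ)) (i : ℕ) : ℕ := (trips.getD (i / 3) (0, 0, 0)).1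

/-- Right vertex of leg `i`, coded in `ℕ`: `0` = constant column (`t = 0`), `a_j + 1` (`t = 1`), `b_j + 1` (`t = 2`). -/
def rvert (trips : List (ℕ × ℕ × ℕ)) (i : ℕ) : ℕ :=
  if i % 3 = 0 then 0 else if i % 3 = 1 then (trips.getD (i / 3) (0, 0, 0)).2.1 + 1
    else (trips.getD (i / 3) (0, 0, 0)).2.2 + 1

/-- Rank of leg `i` in its LEFT fibre: the number of earlier legs with the same left vertex
(the index range is capped at the number of legs `3m`, immaterial for genuine legs `i < 3m`). -/
def rankL (trips : List (ℕ × ℕ × ℕ)) (i : ℕ) : ℕ :=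
  ((List.range (min i (3 * trips.length))).map (lvert trips)).count (lvert trips i)

/-- Rank of leg `i` in its RIGHT fibre. -/
def rankR (trips : List (ℕ × ℕ × ℕ)) (i : ℕ) : ℕ :=
  ((List.range (min i (3 * trips.length))).map (rvert trips)).count (rvert trips i)

/-- The PIECED LEG `i` for block length `L`: `(j, t, c, rankL / L, v, rankR / L)` — output, position, left
vertex, left block, right vertex (coded), right block. -/
def pleg (L : ℕ) (trips : List (ℕ × ℕ × ℕ)) (i : ℕ) : ℕ × ℕ × ℕ × ℕ × ℕ × ℕ :=
  (i / 3, i % 3, lvert trips i, rankL trips i / L, rvert trips i, rankR trips i / L)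

/-- All `3m` pieced legs, in index order. -/
def pieceLegs (L : ℕ) (trips : List (ℕ × ℕ × ℕ)) : List (ℕ × ℕ × ℕ × ℕ × ℕ × ℕ) :=
  (List.range (3 * trips.length)).map (pleg L trips)

/-! ## Index lemmas -/

/-- There are `3m` pieced legs. -/
theorem length_pieceLegs (L : ℕ) (trips : List (ℕ × ℕ × ℕ)) : (pieceLegs L trips).length = 3 * trips.length := by
  simp [pieceLegs]

/-- The `i`-th pieced leg is `pleg L trips i`. -/
theorem pieceLegs_getElem (L : ℕ) (trips : List (ℕ × ℕ × ℕ)) (i : ℕ) (hi : i < (pieceLegs L trips).length) :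
    (pieceLegs L trips)[i] = pleg L trips i := by
  simp [pieceLegs]

variable {n m : ℕ}

/-- Leg `3j + t` of the instance has left vertex `c_j`. -/
theorem lvert_trips (I : LocalMap 3 n m) (j : Fin m) {t : ℕ} (ht : t < 3) :
    lvert (trips I) (3 * j.val + t) = (I.vars j 0).val := by
  have hj : (3 * j.val + t) / 3 = j.val := by omega
  unfold lvert
  rw [hj, trips, List.getD_eq_getElem _ _ (by simp)]
  simp

/-- The head leg `3j` has the constant column as right vertex (code `0`). -/
theorem rvert_trips_zero (I : LocalMap 3 n m) (j : Fin m) : rvert (trips I) (3 * j.val) = 0 := by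
  unfold rvert
  simp

/-- The first data leg `3j + 1` has right vertex `a_j` (code `a_j + 1`). -/
theorem rvert_trips_one (I : LocalMap 3 n m) (j : Fin m) : rvert (trips I) (3 * j.val + 1) = (I.vars j 1).val + 1 := by
  have hj : (3 * j.val + 1) / 3 = j.val := by omega
  have hm : (3 * j.val + 1) % 3 = 1 := by omega
  unfold rvert
  rw [hm, hj, trips, List.getD_eq_getElem _ _ (by simp)]
  simp

/-- The second data leg `3j + 2` has right vertex `b_j` (code `b_j + 1`). -/
theorem rvert_trips_two (I : LocalMap 3 n m) (j : Fin m) : rvert (trips I) (3 * j.val + 2) = (I.vars j 2).val + 1 := by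
  have hj : (3 * j.val + 2) / 3 = j.val := by omega
  have hm : (3 * j.val + 2) % 3 = 2 := by omega
  unfold rvert
  rw [hm, hj, trips, List.getD_eq_getElem _ _ (by simp)]
  simp

/-- For a genuine leg `i < 3m` the left rank is the number of earlier legs with the same left vertex. -/
theorem rankL_eq_countP (trips : List (ℕ × ℕ × ℕ)) {i : ℕ} (hi : i < 3 * trips.length) :
    rankL trips i = (List.range i).countP (fun i' => lvert trips i' = lvert trips i) := by
  unfold rankL
  rw [min_eq_left hi.le, List.count, List.countP_map]
  congr 1

/-- For a genuine leg `i < 3m` the right rank is the number of earlier legs with the same right vertex. -/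
theorem rankR_eq_countP (trips : List (ℕ × ℕ × ℕ)) {i : ℕ} (hi : i < 3 * trips.length) :
    rankR trips i = (List.range i).countP (fun i' => rvert trips i' = rvert trips i) := by
  unfold rankR
  rw [min_eq_left hi.le, List.count, List.countP_map]
  congr 1

/-- Dictionary towards `SfmBlBlockSplit` (Finset form): for a genuine leg `i < 3m`, `rankL` is the number of
indices `i' < i` with the same left vertex. -/
theorem rankL_eq_card (trips : List (ℕ × ℕ × ℕ)) {i : ℕ} (hi : i < 3 * trips.length) :
    rankL trips i = ((Finset.range i).filter (fun i' => lvert trips i' = lvert trips i)).card := by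
  rw [rankL_eq_countP trips hi, List.countP_eq_length_filter]
  rfl

/-- Dictionary towards `SfmBlBlockSplit` (Finset form), right side. -/
theorem rankR_eq_card (trips : List (ℕ × ℕ × ℕ)) {i : ℕ} (hi : i < 3 * trips.length) :
    rankR trips i = ((Finset.range i).filter (fun i' => rvert trips i' = rvert trips i)).card := by
  rw [rankR_eq_countP trips hi, List.countP_eq_length_filter]
  rfl

/-! ## Typing in the `CodeFP` algebra (binary numerals) -/

section PolyTime

open Polynomial

/-- Code of a triple of binary numerals. -/
abbrev tripN : ℕ × ℕ × ℕ → List Bool := pairE natE (pairE natE natE)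

/-- Code of a pieced leg (six binary numerals). -/
abbrev plegE : ℕ × ℕ × ℕ × ℕ × ℕ × ℕ → List Bool :=
  pairE natE (pairE natE (pairE natE (pairE natE (pairE natE natE))))

/-- Re-coding the decoder's unary triples in binary. -/
theorem codeFP_tripsN : CodeFP (rawE tripE) (rawE tripN) (fun l => l) := by
  have h1 : CodeFP tripE tripN (fun t => (t.1, t.2.1, t.2.2)) :=
    (natOfUn.comp (fst _ _)).pair ((natOfUn.comp (snd _ _).fst').pair (natOfUn.comp (snd _ _).snd'))
  exact (map₀ (h1.congr fun t => rfl)).congr fun l => by simp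

/-- Reading triple `j` (default `(0,0,0)` past the end). -/
theorem codeFP_getTrip : CodeFP (pairE (rawE tripN) natE) tripN (fun p => p.1.getD p.2 (0, 0, 0)) :=
  ((rawGetOr tripN).comp ((fst _ _).pair ((snd _ _).pair
    (const (pairE (rawE tripN) natE) (eβ := tripN) ((0 : ℕ), (0 : ℕ), (0 : ℕ)))))).congr fun _ => rfl

/-- The output index `i / 3` of leg `i`. -/
theorem codeFP_legOut : CodeFP (pairE (rawE tripN) natE) natE (fun p => p.2 / 3) :=
  (natDiv.comp ((snd _ _).pair (const _ (3 : ℕ)))).congr fun _ => rfl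

/-- The position `i % 3` of leg `i`. -/
theorem codeFP_legPos : CodeFP (pairE (rawE tripN) natE) natE (fun p => p.2 % 3) :=
  (natMod.comp ((snd _ _).pair (const _ (3 : ℕ)))).congr fun _ => rfl

/-- The triple of leg `i`. -/
theorem codeFP_legTrip : CodeFP (pairE (rawE tripN) natE) tripN (fun p => p.1.getD (p.2 / 3) (0, 0, 0)) :=
  (codeFP_getTrip.comp ((fst _ _).pair codeFP_legOut)).congr fun _ => rfl

/-- `lvert` is polynomial time. -/
theorem codeFP_lvert : CodeFP (pairE (rawE tripN) natE) natE (fun p => lvert p.1 p.2) :=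
  codeFP_legTrip.fst'.congr fun _ => rfl

/-- `rvert` is polynomial time. -/
theorem codeFP_rvert : CodeFP (pairE (rawE tripN) natE) natE (fun p => rvert p.1 p.2) := by
  have h0 : CodeFP (pairE (rawE tripN) natE) bitE (fun p => decide (p.2 % 3 = 0)) :=
    (natEq.comp (codeFP_legPos.pair (const _ (0 : ℕ)))).congr fun _ => rfl
  have h1 : CodeFP (pairE (rawE tripN) natE) bitE (fun p => decide (p.2 % 3 = 1)) :=
    (natEq.comp (codeFP_legPos.pair (const _ (1 : ℕ)))).congr fun _ => rfl
  have ha : CodeFP (pairE (rawE tripN) natE) natE (fun p => (p.1.getD (p.2 / 3) (0, 0, 0)).2.1 + 1) :=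
    (natAdd.comp (codeFP_legTrip.snd'.fst'.pair (const _ (1 : ℕ)))).congr fun _ => rfl
  have hb : CodeFP (pairE (rawE tripN) natE) natE (fun p => (p.1.getD (p.2 / 3) (0, 0, 0)).2.2 + 1) :=
    (natAdd.comp (codeFP_legTrip.snd'.snd'.pair (const _ (1 : ℕ)))).congr fun _ => rfl
  exact (h0.ite (const _ (0 : ℕ)) (h1.ite ha hb)).congr fun p => by
    unfold rvert
    by_cases e0 : p.2 % 3 = 0
    · simp [e0]
    · by_cases e1 : p.2 % 3 = 1
      · simp [e1]
      · simp [e0, e1]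

/-- The unary numeral `3m` from the triple list. -/
theorem codeFP_threeLen : CodeFP (rawE tripN) unE (fun l => 3 * l.length) :=
  (unAdd.comp ((ulength tripN).pair (unAdd.comp ((ulength tripN).pair (ulength tripN))))).congr
    fun l => by show l.length + (l.length + l.length) = 3 * l.length; omega

/-- The index range `[0, 3m)` of the legs. -/
theorem codeFP_legRange : CodeFP (rawE tripN) (rawE natE) (fun l => List.range (3 * l.length)) :=
  (urange.comp codeFP_threeLen).congr fun _ => rfl

/-- The capped range `[0, min i 3m)` of the earlier legs. -/
theorem codeFP_earlier : CodeFP (pairE (rawE tripN) natE) (rawE natE)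
    (fun p => List.range (min p.2 (3 * p.1.length))) :=
  ((brange natE).comp ((codeFP_legRange.comp (fst _ _)).pair (snd _ _))).congr fun p => by
    simp [List.length_range]

/-- `rankL` is polynomial time. -/
theorem codeFP_rankL : CodeFP (pairE (rawE tripN) natE) natE (fun p => rankL p.1 p.2) := by
  have hl : CodeFP (pairE (rawE tripN) natE) (rawE natE)
      (fun p => (List.range (min p.2 (3 * p.1.length))).map (fun i' => lvert p.1 i')) :=
    ((map codeFP_lvert).comp ((fst _ _).pair codeFP_earlier)).congr fun _ => rfl
  exact (rawCountNat.comp (codeFP_lvert.pair hl)).congr fun _ => rfl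

/-- `rankR` is polynomial time. -/
theorem codeFP_rankR : CodeFP (pairE (rawE tripN) natE) natE (fun p => rankR p.1 p.2) := by
  have hl : CodeFP (pairE (rawE tripN) natE) (rawE natE)
      (fun p => (List.range (min p.2 (3 * p.1.length))).map (fun i' => rvert p.1 i')) :=
    ((map codeFP_rvert).comp ((fst _ _).pair codeFP_earlier)).congr fun _ => rfl
  exact (rawCountNat.comp (codeFP_rvert.pair hl)).congr fun _ => rfl

/-- The pieced leg is polynomial time (block length `L` a constant of the algorithm). -/
theorem codeFP_pleg (L : ℕ) : CodeFP (pairE (rawE tripN) natE) plegE (fun p => pleg L p.1 p.2) :=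
  (codeFP_legOut.pair (codeFP_legPos.pair (codeFP_lvert.pair
    ((natDiv.comp (codeFP_rankL.pair (const _ L))).pair (codeFP_rvert.pair
      (natDiv.comp (codeFP_rankR.pair (const _ L)))))))).congr fun _ => rfl

/-- **M1: the list of pieced legs is computed on codes in polynomial time.** -/
theorem codeFP_pieceLegs (L : ℕ) : CodeFP (rawE tripN) (rawE plegE) (pieceLegs L) :=
  ((map (codeFP_pleg L)).comp ((CodeFP.id (rawE tripN)).pair codeFP_legRange)).congr fun _ => rfl

/-- M1 on the TOKENS of the code of a pure-`CAND` instance (after the landed decoder `tripsTok`). -/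
theorem codeFP_pieceLegsTok (L : ℕ) : CodeFP (rawE unE) (rawE plegE) (fun ts => pieceLegs L (tripsTok ts)) :=
  ((codeFP_pieceLegs L).comp (codeFP_tripsN.comp codeFP_tripsTok)).congr fun _ => rfl

end PolyTime

end Summit.PneNP.PneNP.Theorems.SfmBlMachine
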